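import Summits.QuantumFields.YangMills.Theorems.UnitScaleTiltProp7FlatHodgeCoercivity
import Literature.MathematicalPhysics.QuantumFieldTheory.Balaban1983to89.LatticeFieldCalculus
import HarnessLib

/-!
# Route `UnitScaleTilt`, crux K1 child «MinimiserStabilityRegPr» (stmt-QuantumFields-19200), registered stub `stub_prop7From14` (v4 828f5fb4a904d3be;
# leaf V3 «Prop 7 from a background (14)») — sub-lemma V3-D1a′: THE STRAIGHT-LINE BLOCK AVERAGE OF p451004 **IS** THE TREE's ITERATED LINEAR
# BOND AVERAGE `LatticeFieldCalculus.bondAvgIter k` ([Balaban1984PropagatorsI] (1.18) in one stroke), HENCE (1.90) AT `U = 1` IN `L²` FORM FOR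
# `Q_k` OF RECORD: `Σ_b X² ≤ 2L^{kd}Σ_c(Q_kX)² + (17/8)L^{2k}(Σ_p(∂X)² + Σ_x(∂^*X)²)`, `k`-uniform

Cell `ym3-torus` ∕ fleet seat `ym-ust-19200-p1` (HUMAN RULING D-0037, YM ladder rung R3).  Third file of the V3-D1 series (`UnitScaleTiltProp7FlatCoercivity`
p451004: the `k`-uniform flat Poincaré–coercivity for the straight-line `e`-fold block average `M_e` written out as an explicit term;
`UnitScaleTiltProp7FlatHodgeCoercivity` p452018: its Hodge form through the tree's (1.21) Weitzenböck identity `B5Eq121Form`).  Here the explicit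
average is IDENTIFIED with the series' vocabulary of record: `LatticeFieldCalculus.bondAvgIter k` — the `k`-fold composition of the one-step linear
bond averages `(QA)(c) = L^{−(d+1)} Σ_{x∈B(c₋)} A([x, x(c)])` of [Balaban1984PropagatorsI] (1.11), whose one-stroke form (1.18) is
«(Q_kA)_b = Σ_{x∈B^k(b₋)} η^{d+1} A([x, x(b)])».

WHAT IS PROVED (sorry-free, no definition; every torus `Setup.Params`, `k` in the standing range `k ≤ m + K`).
* §1–§3 bookkeeping [folklore]: straight contours as iterated unit shifts (`iterate_shift_eq_runSite`), `k`-blocks translate by `L^k` fine steps under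
  one coarse step (`fibreSite_runSite`, `sum_fibre_runSite`), `B^{k+1}(z) = ⋃_{y∈B(z)} B^k(y)` as sums (`sum_fibre_succ`), the block `B(z)` by offsets
  (`sum_block_eq_sum_offsets`), splitting a contour of `L·L^k` bonds (`sum_range_mul_eq`).
* §4 **`bondAvgIter_eq_lineBlockAvg`** ((1.18), any `ℝ`-module of values): `(Q_kX)(⟨z, μ⟩) = L^{−k(d+1)}·Σ_{x : proj_k x = z} Σ_{t<L^k} X(⟨x + t e_μ, μ⟩)`,
  by induction on `k` through the one-step definition; `…_real`.
* §5 **`sum_sq_le_bondAvgIter_add_grad`**, **`sum_sq_le_bondAvgIter_add_curl_add_diverg`**: (1.90) at `U = 1` in `L²` form for `Q_k` of record,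
  gradient and Hodge forms, constants `2L^{kd}`, `(17/8)L^{2k}` — independent of the volume and of `k`;
  **`curl_sq_ge_of_landau_of_bondAvgIter_eq_zero`**: `∂^*X = 0 ∧ Q_kX = 0 ⇒ (8/17)L^{−2k}Σ_b X² ≤ Σ_p(∂X)²` — [Balaban1985BackgroundPropagators]
  Thm 3.11 at the flat background on `ker Q_k` in the (full) Landau gauge, `L²` form; `…_T3` the instance at the d = 3 carrier (`Site (F.P K) 0`,
  `k = K − n`).

WHAT THIS IS NOT.  As in the siblings: the residual-gauge projection `R` of (1.72) (Landau condition off the block-constant modes only), the small-field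
perturbation to a background `U₀ ∈ 𝔘_k(L³B₃ε₁)` (V3-D2), the identification of `Q_k` with the derivative at `U ≡ 1` of the family's NONLINEAR (0.4)
descent (V3-D1c: main term `Q_k` plus contour corrections that are gradient sums), and the sup-norm ∕ decay theory (V3-D3) are not here.  Nothing of
Bałaban's is asserted.

References: T. Bałaban, CMP 95 (1984) 17–40 [Balaban1984PropagatorsI] ((1.7)–(1.8) pp.18–19, (1.11) p.19, (1.18) p.20, Prop. 1.1 (1.90) p.33);
CMP 99 (1985) 389–434 [Balaban1985BackgroundPropagators] (Thm 3.11 p.416); CMP 109 (1987) 249–301 [Balaban1987RG1] ((0.1) p.251).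
-/

noncomputable section

open scoped BigOperators

namespace Summit.QuantumFields.YangMills.Theorems.Prop7FlatCoercivity

open Literature.MathematicalPhysics.QuantumFieldTheory.Balaban1983to89
open Finset LatticeFieldCalculus B1RG242Torus
open B10StarCount (sum_pbond)

variable {P : Params}

/-! ## §1 Straight contours as iterated unit shifts -/

/-- The `t`-th site `x + t·e_μ` of the straight contour is the `t`-fold unit shift of `x`. [cite: Balaban1984PropagatorsI, (1.7) p.18] -/
theorem iterate_shift_eq_runSite {j : ℕ} (x : Site P j) (μ : Fin P.d) (t : ℕ) :
    (fun z : Site P j => z.shift μ)^[t] x = runSite x μ t := by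
  induction t with
  | zero => simp
  | succ t ih => rw [Function.iterate_succ_apply', ih, runSite_succ]

/-- Straight contours compose: `(x + a e_μ) + b e_μ = x + (a + b) e_μ`. [cite: Balaban1984PropagatorsI, (1.7) p.18] -/
theorem runSite_runSite {j : ℕ} (x : Site P j) (μ : Fin P.d) (a b : ℕ) :
    runSite (runSite x μ a) μ b = runSite x μ (a + b) := by
  simp only [runSite, Function.update_idem, Function.update_self]
  push_cast
  rw [add_assoc]

/-- A straight run changes only the `μ`-coordinate. [folklore] -/
theorem runSite_apply_of_ne {j : ℕ} (x : Site P j) {μ ν : Fin P.d} (h : ν ≠ μ) (t : ℕ) :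
    runSite x μ t ν = x ν := by
  simp only [runSite, Function.update_of_ne h]

/-- The `μ`-coordinate of a straight run. [folklore] -/
theorem runSite_apply_self {j : ℕ} (x : Site P j) (μ : Fin P.d) (t : ℕ) :
    runSite x μ t μ = x μ + t := by
  simp only [runSite, Function.update_self]

/-! ## §2 Fibres of the `k`-fold block map: translation and composition -/

section Fibres

variable {k : ℕ}

/-- **TRANSLATING A `k`-BLOCK BY ONE COARSE STEP TRANSLATES ITS FINE SITES BY `L^k` STEPS** (offsets preserved): the `e`-fold analogue of
`LatticeFieldCalculus.runSite_blockSite_L` («`x(c)` … obtained by translation of `x` by the bond `c`»). [cite: Balaban1984PropagatorsI, (1.8) p.19] -/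
theorem fibreSite_runSite (h : P.sitesPerDir 0 = P.L ^ k * P.sitesPerDir k) (y : Site P k) (μ : Fin P.d) (s : ℕ)
    (r : Fin P.d → Fin (P.L ^ k)) :
    Site.fibreSite 0 k (runSite y μ s) r = runSite (Site.fibreSite 0 k y r) μ (s * P.L ^ k) := by
  funext ν
  by_cases hν : ν = μ
  · subst hν
    rw [runSite_apply_self]
    simp only [Site.fibreSite, runSite_apply_self]
    rw [← Nat.cast_add, ZMod.natCast_eq_natCast_iff, h]
    -- `((y+s) mod N_k)·L^k + r ≡ y·L^k + r + s·L^k  (mod L^k·N_k)`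
    have hval : ((y ν + (s : ZMod (P.sitesPerDir k))) : ZMod (P.sitesPerDir k)).val = ((y ν).val + s) % P.sitesPerDir k := by
      rw [ZMod.val_add, ZMod.val_natCast]
      simp [Nat.add_mod]
    rw [hval]
    have h1 : ((y ν).val + s) % P.sitesPerDir k * P.L ^ k ≡ ((y ν).val + s) * P.L ^ k [MOD P.sitesPerDir k * P.L ^ k] :=
      Nat.ModEq.mul_right' _ (Nat.mod_modEq _ _)
    rw [mul_comm (P.L ^ k) (P.sitesPerDir k)]
    have h2 := Nat.ModEq.add_right (r ν : ℕ) h1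
    refine h2.trans ?_
    have : ((y ν).val + s) * P.L ^ k + (r ν : ℕ) = (y ν).val * P.L ^ k + (r ν : ℕ) + s * P.L ^ k := by ring
    rw [this]
  · rw [runSite_apply_of_ne _ hν]
    simp only [Site.fibreSite, runSite_apply_of_ne _ hν]

/-- A sum over the fibre `B^k(y′)` parametrised by the offsets. [folklore] -/
theorem sum_fibre_eq_sum_offsets (h : P.sitesPerDir 0 = P.L ^ k * P.sitesPerDir k) {M : Type*} [AddCommMonoid M]
    (y : Site P k) (G : Site P 0 → M) :
    ∑ x ∈ univ.filter (fun x : Site P 0 => Site.proj k k x = y), G x = ∑ r : Fin P.d → Fin (P.L ^ k), G (Site.fibreSite 0 k y r) := by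
  rw [← Finset.sum_coe_sort]
  have hmem : ∀ x : Site P 0, x ∈ univ.filter (fun x : Site P 0 => Site.proj k k x = y) ↔ Site.proj k k x = y := fun x => by simp
  let e : ↥(univ.filter (fun x : Site P 0 => Site.proj k k x = y)) ≃ (Fin P.d → Fin (P.L ^ k)) :=
    (Equiv.subtypeEquivRight hmem).trans (Site.fibreEquiv h y)
  rw [← Equiv.sum_comp e.symm]
  rfl

/-- **TRANSLATION OF FIBRES**: summing over the `k`-block of `y + s·e_μ` is summing over the `k`-block of `y` translated by `s·L^k`
fine steps in the direction `μ`. [cite: Balaban1984PropagatorsI, (1.8) p.19] -/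
theorem sum_fibre_runSite (h : P.sitesPerDir 0 = P.L ^ k * P.sitesPerDir k) {M : Type*} [AddCommMonoid M]
    (y : Site P k) (μ : Fin P.d) (s : ℕ) (G : Site P 0 → M) :
    ∑ x ∈ univ.filter (fun x : Site P 0 => Site.proj k k x = runSite y μ s), G x
      = ∑ x ∈ univ.filter (fun x : Site P 0 => Site.proj k k x = y), G (runSite x μ (s * P.L ^ k)) := by
  rw [sum_fibre_eq_sum_offsets h, sum_fibre_eq_sum_offsets h]
  simp only [fibreSite_runSite h]

/-- **COMPOSITION OF FIBRES**: `B^{k+1}(z) = ⋃_{y ∈ B(z)} B^k(y)` as an identity of sums ([Balaban1982Higgs1] (2.12) «Γ^{(k+1)}_{z,x} =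
Γ^{(k)}_{y,x} ∪ Γ_{z,y}»). [cite: Balaban1984PropagatorsI, (1.18) p.20] -/
theorem sum_fibre_succ (h : P.sitesPerDir 0 = P.L ^ k * P.sitesPerDir k) (h' : P.sitesPerDir k = P.L ^ 1 * P.sitesPerDir (k + 1))
    {M : Type*} [AddCommMonoid M] (z : Site P (k + 1)) (H : Site P 0 → M) :
    ∑ y ∈ univ.filter (fun y : Site P k => blockOf y = z), ∑ x ∈ univ.filter (fun x : Site P 0 => Site.proj k k x = y), H x
      = ∑ x ∈ univ.filter (fun x : Site P 0 => Site.proj (k + 1) (k + 1) x = z), H x := by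
  have hc : ∀ x : Site P 0, Site.proj (k + 1) (k + 1) x = blockOf (Site.proj k k x) := fun x => by
    rw [← Site.proj_one_eq_blockOf, Site.proj_comp h h']
  rw [← Finset.sum_fiberwise_of_maps_to (s := univ.filter (fun x : Site P 0 => Site.proj (k + 1) (k + 1) x = z))
    (t := univ.filter (fun y : Site P k => blockOf y = z)) (g := Site.proj k k)
    (fun x hx => by simp only [Finset.mem_filter, Finset.mem_univ, true_and] at hx ⊢; rw [← hc, hx])]
  refine Finset.sum_congr rfl fun y hy => ?_
  have hy' : blockOf y = z := (Finset.mem_filter.mp hy).2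
  congr 1
  ext x
  simp only [Finset.mem_filter, Finset.mem_univ, true_and]
  constructor
  · intro hx; exact ⟨by rw [hc, hx, hy'], hx⟩
  · intro hx; exact hx.2

end Fibres

/-! ## §3 One-step blocks by offsets; splitting a long straight contour into coarse steps -/

/-- A sum over the block `B(z)` parametrised by the offsets `{0,…,L−1}^d` (standing range). [folklore] -/
theorem sum_block_eq_sum_offsets {j : ℕ} (hj : j + 1 ≤ P.m + P.K) {M : Type*} [AddCommMonoid M] (z : Site P (j + 1))
    (G : Site P j → M) :
    ∑ y ∈ univ.filter (fun y : Site P j => blockOf y = z), G y = ∑ r : Fin P.d → Fin P.L, G (Site.blockSite z r) := by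
  rw [← Finset.sum_coe_sort]
  have hmem : ∀ y : Site P j, y ∈ univ.filter (fun y : Site P j => blockOf y = z) ↔ blockOf y = z := fun y => by simp
  let e : ↥(univ.filter (fun y : Site P j => blockOf y = z)) ≃ (Fin P.d → Fin P.L) :=
    (Equiv.subtypeEquivRight hmem).trans (Site.blockEquiv hj z)
  rw [← Equiv.sum_comp e.symm]
  rfl

/-- Splitting the straight contour of `a·N` bonds into `a` consecutive pieces of `N` bonds. [folklore] -/
theorem sum_range_mul_eq {M : Type*} [AddCommMonoid M] (g : ℕ → M) (a N : ℕ) :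
    ∑ s ∈ range a, ∑ t ∈ range N, g (s * N + t) = ∑ u ∈ range (a * N), g u := by
  induction a with
  | zero => simp
  | succ a ih => rw [Finset.sum_range_succ, ih, Nat.succ_mul, Finset.sum_range_add]

/-! ## §4 The identification -/

/-- **THE ITERATED LINEAR BOND AVERAGE IS THE STRAIGHT-LINE BLOCK AVERAGE** ([Balaban1984PropagatorsI] (1.18): «(Q_kA)_b = Σ_{x∈B^k(b₋)}
η^{d+1} A([x, x(b)])» — the `k`-fold composition `LatticeFieldCalculus.bondAvgIter k` of the one-step averages (1.11) written in one stroke):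
for every bond field `X` on the finest torus and every bond `c = ⟨z, z + e_μ⟩` of `T^{(k)}` (`k` in the standing range),
`(Q_kX)(c) = L^{−k(d+1)}·Σ_{x ∈ B^k(z)} Σ_{t<L^k} X(⟨x + t e_μ, μ⟩)`, the block `B^k(z) = {x : proj_k x = z}` and `x + t e_μ` the `t`-fold
unit shift — i.e. exactly the average `M_k` of `Prop7FlatCoercivity.sum_sq_le_lineBlockAvg_add_grad` at `i = 0`, `i′ = e = k`.
[cite: Balaban1984PropagatorsI, (1.18) p.20] -/
theorem bondAvgIter_eq_lineBlockAvg {V : Type*} [AddCommGroup V] [Module ℝ V] :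
    ∀ {k : ℕ}, k ≤ P.m + P.K → ∀ (X : VecField P 0 V) (c : PBond P k),
      bondAvgIter k X c = ((((P.L : ℝ) ^ k) ^ P.d * (P.L : ℝ) ^ k)⁻¹) •
        ∑ x ∈ univ.filter (fun x : Site P 0 => Site.proj k k x = c.src),
          ∑ t ∈ range (P.L ^ k), X ⟨(fun z : Site P 0 => z.shift c.dir)^[t] x, c.dir⟩
  | 0, _, X, c => by
    obtain ⟨z, μ⟩ := c
    have hf : univ.filter (fun x : Site P 0 => Site.proj 0 0 x = z) = {z} := by
      ext x; simp [Site.proj_zero]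
    simp only [hf, bondAvgIter, id, pow_zero, one_pow, mul_one, inv_one, one_smul, Finset.sum_singleton, Finset.range_one,
      Function.iterate_zero]
  | k + 1, hk, X, c => by
    have hk' : k ≤ P.m + P.K := by omega
    have h0k : P.sitesPerDir 0 = P.L ^ k * P.sitesPerDir k := by rw [sitesPerDir_zero_eq P k, lvl_of_le P hk']
    have hk1 : P.sitesPerDir k = P.L ^ 1 * P.sitesPerDir (k + 1) := by
      rw [pow_one, mul_comm]; exact P.sitesPerDir_eq_mul_succ hk
    -- one step of (1.11) on top of the inductive hypothesis
    have step1 : bondAvgIter (k + 1) X c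
        = (((P.L : ℝ) ^ (P.d + 1))⁻¹) • ∑ r : Fin P.d → Fin P.L, ∑ s ∈ range P.L,
            ((((P.L : ℝ) ^ k) ^ P.d * (P.L : ℝ) ^ k)⁻¹ •
              ∑ x ∈ univ.filter (fun x : Site P 0 => Site.proj k k x = runSite (Site.blockSite c.src r) c.dir s),
                ∑ t ∈ range (P.L ^ k), X ⟨(fun z : Site P 0 => z.shift c.dir)^[t] x, c.dir⟩) := by
      show bondAvg (bondAvgIter k X) c = _
      simp only [bondAvg, segSum, runBond, bondAvgIter_eq_lineBlockAvg hk' X]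
    -- offsets ↦ the block `B(z)`
    have step2 := sum_block_eq_sum_offsets hk c.src (fun y => ∑ s ∈ range P.L,
            ((((P.L : ℝ) ^ k) ^ P.d * (P.L : ℝ) ^ k)⁻¹ •
              ∑ x ∈ univ.filter (fun x : Site P 0 => Site.proj k k x = runSite y c.dir s),
                ∑ t ∈ range (P.L ^ k), X ⟨(fun z : Site P 0 => z.shift c.dir)^[t] x, c.dir⟩))
    beta_reduce at step2
    -- translate the fibres and merge the `L` pieces of the long contour
    have step3 : ∀ y : Site P k, ∑ s ∈ range P.L,
          ((((P.L : ℝ) ^ k) ^ P.d * (P.L : ℝ) ^ k)⁻¹ •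
            ∑ x ∈ univ.filter (fun x : Site P 0 => Site.proj k k x = runSite y c.dir s),
              ∑ t ∈ range (P.L ^ k), X ⟨(fun z : Site P 0 => z.shift c.dir)^[t] x, c.dir⟩)
        = (((P.L : ℝ) ^ k) ^ P.d * (P.L : ℝ) ^ k)⁻¹ •
            ∑ x ∈ univ.filter (fun x : Site P 0 => Site.proj k k x = y),
              ∑ u ∈ range (P.L ^ (k + 1)), X ⟨(fun z : Site P 0 => z.shift c.dir)^[u] x, c.dir⟩ := by
      intro y
      rw [← Finset.smul_sum]
      congr 1
      simp only [sum_fibre_runSite h0k, iterate_shift_eq_runSite, runSite_runSite]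
      rw [Finset.sum_comm]
      refine Finset.sum_congr rfl fun x _ => ?_
      rw [pow_succ', ← sum_range_mul_eq (fun u => X ⟨runSite x c.dir u, c.dir⟩) P.L (P.L ^ k)]
    rw [step1, ← step2, Finset.sum_congr rfl fun y _ => step3 y, ← Finset.smul_sum, sum_fibre_succ h0k hk1, smul_smul]
    congr 1
    rw [← mul_inv]
    congr 1
    ring

/-- The same for REAL bond fields, with `•` read as multiplication (the form used by `sum_sq_le_lineBlockAvg_add_grad`).
[cite: Balaban1984PropagatorsI, (1.18) p.20] -/
theorem bondAvgIter_eq_lineBlockAvg_real {k : ℕ} (hk : k ≤ P.m + P.K) (X : VecField P 0 ℝ) (c : PBond P k) :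
    bondAvgIter k X c = (((P.L : ℝ) ^ k) ^ P.d * (P.L : ℝ) ^ k)⁻¹ *
      ∑ x ∈ univ.filter (fun x : Site P 0 => Site.proj k k x = c.src),
        ∑ t ∈ range (P.L ^ k), X ⟨(fun z : Site P 0 => z.shift c.dir)^[t] x, c.dir⟩ := by
  rw [bondAvgIter_eq_lineBlockAvg hk X c, smul_eq_mul]

/-! ## §5 [Balaban1984PropagatorsI] Prop. 1.1 (1.90) at the flat background, `L²` form, in the tree's vocabulary -/

/-- The finest torus lies `k` block levels above `T^{(k)}` (standing range). [cite: Balaban1987RG1, (0.1) p.251] -/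
theorem sitesPerDir_zero_eq_pow_mul {k : ℕ} (hk : k ≤ P.m + P.K) : P.sitesPerDir 0 = P.L ^ k * P.sitesPerDir k := by
  rw [sitesPerDir_zero_eq P k, lvl_of_le P hk]

/-- **(1.90) AT `U = 1`, GRADIENT FORM, FOR THE ITERATED LINEAR AVERAGE `Q_k` OF RECORD**: for every real bond field `X` on the finest torus
and every `k` in the standing range, `Σ_b X(b)² ≤ 2L^{kd}·Σ_c (Q_kX)(c)² + (17/8)L^{2k}·Σ_b Σ_ν (X(b+e_ν) − X(b))²`
(`Q_k = LatticeFieldCalculus.bondAvgIter k`), constants independent of the volume and of `k` — «γ₀ independent of k, T_η».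
[cite: Balaban1984PropagatorsI, Prop. 1.1 (1.90) p.33] -/
theorem sum_sq_le_bondAvgIter_add_grad {k : ℕ} (hk : k ≤ P.m + P.K) (X : VecField P 0 ℝ) :
    ∑ b : PBond P 0, X b ^ 2
      ≤ 2 * ((P.L : ℝ) ^ k) ^ P.d * ∑ c : PBond P k, bondAvgIter k X c ^ 2
        + (17 / 8) * ((P.L : ℝ) ^ k) ^ 2 * ∑ b : PBond P 0, ∑ ν : Fin P.d, (X ⟨b.src.shift ν, b.dir⟩ - X b) ^ 2 := by
  simp only [bondAvgIter_eq_lineBlockAvg_real hk]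
  exact sum_sq_le_lineBlockAvg_add_grad (sitesPerDir_zero_eq_pow_mul hk) X

/-- **(1.90) AT `U = 1`, HODGE FORM**: `Σ_b X(b)² ≤ 2L^{kd}·Σ_c (Q_kX)(c)² + (17/8)L^{2k}·(Σ_p (∂X)(p)² + Σ_x (∂^*X)(x)²)` — the quadratic form of
`∂^*∂ + ∂∂^* + a·Q_k^*Q_k` on the finest torus is bounded below by `(8/17)L^{−2k}`, uniformly in the volume and in `k`
([Balaban1984PropagatorsI] (1.69)/(1.72) with the full divergence in place of `∂R∂^*`). [cite: Balaban1984PropagatorsI, Prop. 1.1 (1.90) p.33] -/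
theorem sum_sq_le_bondAvgIter_add_curl_add_diverg {k : ℕ} (hk : k ≤ P.m + P.K) (X : VecField P 0 ℝ) :
    ∑ b : PBond P 0, X b ^ 2
      ≤ 2 * ((P.L : ℝ) ^ k) ^ P.d * ∑ c : PBond P k, bondAvgIter k X c ^ 2
        + (17 / 8) * ((P.L : ℝ) ^ k) ^ 2 * (∑ p : Plaq P 0, (curl 1 X p) ^ 2 + ∑ x : Site P 0, (diverg 1 X x) ^ 2) := by
  rw [← sum_grad_sq_eq_curl_add_diverg]
  exact sum_sq_le_bondAvgIter_add_grad hk X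

/-- **THM 3.11 AT THE FLAT BACKGROUND, `L²` FORM, ON `ker Q_k` IN THE LANDAU GAUGE**: if `∂^*X = 0` and `Q_kX = 0` then
`(8/17)·L^{−2k}·Σ_b X(b)² ≤ Σ_p (∂X)(p)²` — the linearised Wilson Hessian at `U ≡ 1` is coercive at rate `L^{−2k}` on the Landau-gauge bond
fields with vanishing `k`-fold linear block averages, uniformly in the volume and in `k`. [cite: Balaban1985BackgroundPropagators, Thm 3.11 p.416] -/
theorem curl_sq_ge_of_landau_of_bondAvgIter_eq_zero {k : ℕ} (hk : k ≤ P.m + P.K) (X : VecField P 0 ℝ)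
    (hdiv : ∀ x : Site P 0, diverg 1 X x = 0) (havg : ∀ c : PBond P k, bondAvgIter k X c = 0) :
    (8 / 17) * (((P.L : ℝ) ^ k) ^ 2)⁻¹ * ∑ b : PBond P 0, X b ^ 2 ≤ ∑ p : Plaq P 0, (curl 1 X p) ^ 2 := by
  have hm := sum_sq_le_bondAvgIter_add_curl_add_diverg hk X
  simp only [havg, hdiv, sq, mul_zero, Finset.sum_const_zero, add_zero] at hm
  have hL : (0 : ℝ) < ((P.L : ℝ) ^ k) ^ 2 := by
    have : (0 : ℝ) < P.L := by exact_mod_cast P.L_pos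
    positivity
  rw [show (8 / 17 : ℝ) * (((P.L : ℝ) ^ k) ^ 2)⁻¹ * ∑ b : PBond P 0, X b ^ 2 = ((8 / 17) * ∑ b : PBond P 0, X b ^ 2) / ((P.L : ℝ) ^ k) ^ 2 by
    field_simp]
  rw [div_le_iff₀ hL]
  have e1 : ∑ b : PBond P 0, X b ^ 2 = ∑ b : PBond P 0, X b * X b := Finset.sum_congr rfl fun b _ => sq _
  have e2 : ∑ p : Plaq P 0, curl 1 X p ^ 2 = ∑ p : Plaq P 0, curl 1 X p * curl 1 X p := Finset.sum_congr rfl fun p _ => sq _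
  rw [e1, e2]
  nlinarith [hm]

/-- **AT THE d = 3 CARRIER** of `T3Thm1Carrier.varProblem3 F n K` (finest torus `Site (F.P K) 0`, `k = K − n` averaging levels of the family's
block size `L`): Landau gauge and `Q_{K−n}X = 0` give `(8/17)L^{−2(K−n)}·Σ_b X(b)² ≤ Σ_p (∂X)(p)²`, uniformly in `m`, `n`, `K`.
[cite: Balaban1985BackgroundPropagators, Thm 3.11 p.416] -/
theorem curl_sq_ge_of_landau_of_bondAvgIter_eq_zero_T3 (F : T3ContinuumYM3Torus.T3Family) (n K : ℕ) (X : VecField (F.P K) 0 ℝ)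
    (hdiv : ∀ x : Site (F.P K) 0, diverg 1 X x = 0) (havg : ∀ c : PBond (F.P K) (K - n), bondAvgIter (K - n) X c = 0) :
    (8 / 17) * (((F.L : ℝ) ^ (K - n)) ^ 2)⁻¹ * ∑ b : PBond (F.P K) 0, X b ^ 2 ≤ ∑ p : Plaq (F.P K) 0, (curl 1 X p) ^ 2 :=
  curl_sq_ge_of_landau_of_bondAvgIter_eq_zero (P := F.P K) (show K - n ≤ F.m + K by omega) X hdiv havg

end Summit.QuantumFields.YangMills.Theorems.Prop7FlatCoercivity

end
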